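import Literature.NumberTheory.EllipticCurves.Curve346SelmerCertificatesB
import HarnessLib

/-!
# The 16 point classes of `S(692, 114240)` and `dim₂ S(692, 114240) = 6` = `dim₂ S^{(φ)}(X/ℚ)` for `X = [0, -346, 0, 1369, 0]`

Topic `NumberTheory/EllipticCurves`. Fourth file of the rank-`2` isogeny-door cell. The classes
`[1, 5, 6, -14, -17, -21, 30, -70, -85, -102, -105, 238, 357, -510, 1190, 1785]` of `S(692, 114240)` are realised by rational points of `X' = [0, 692, 0, 114240, 0]`
(integral points of the quartics `w² = d u⁴ + 692 u²z² + (114240/d) z⁴`); together with the 17 certified classes of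
`Curve346SelmerCertificatesA`/`…B` this gives `#S(692, 114240) ≥ 33 > 32`, and since `#S = 2^{dim} ≤ 2^{ω(114240)+1} = 64`:
**`dim₂ S(692, 114240) = 6`** — all `64` classes are everywhere locally soluble. Theorems only.

## References

* [SilvermanAEC2009] J. H. Silverman, *AEC*, 2nd ed.: Prop. X.4.9.
* [SilvermanTate2015] J. H. Silverman, J. Tate, *Rational Points on Elliptic Curves*, §3.5–§3.6.
-/

noncomputable section

open scoped Classical

namespace Literature.NumberTheory.EllipticCurves

namespace Curve346

open _root_.WeierstrassCurve _root_.WeierstrassCurve.Affine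

/-- `b(a² − 4b) ≠ 0` for `(a, b) = (692, 114240)`. [cite: SilvermanAEC2009, Prop. X.4.9] -/
private theorem hab' : (114240 : ℤ) * ((692 : ℤ) ^ 2 - 4 * 114240) ≠ 0 := by norm_num

/-- An integral point `f(u, z) = w²` gives a point over every field of characteristic `0`. [folklore] -/
private theorem isSoluble_of_int_point {R : Type*} [Field R] [CharZero R] {d e u z w : ℤ}
    (huz : u ≠ 0 ∨ z ≠ 0) (h : d * u ^ 4 + 692 * u ^ 2 * z ^ 2 + e * z ^ 4 = w ^ 2) :
    ((twoIsogenyQuartic 692 d e).map (Int.castRingHom R)).IsSoluble := by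
  refine ⟨u, z, w, ?_, ?_⟩
  · rcases huz with h | h
    · exact Or.inl (by exact_mod_cast h)
    · exact Or.inr (by exact_mod_cast h)
  · rw [eval_map_twoIsogenyQuartic]
    simp only [eq_intCast]
    exact_mod_cast h.symm


/-- Squarefreeness of a (small) integer from the factorisation of its absolute value. [folklore] -/
private theorem squarefree_int_of_natAbs {d : ℤ} {n : ℕ} (h : d.natAbs = n) (hn : n ≠ 0)
    (hnd : n.primeFactorsList.Nodup) : Squarefree d :=
  Int.squarefree_natAbs.mp (h ▸ (Nat.squarefree_iff_nodup_primeFactorsList hn).mpr hnd)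

/-! ## 1. The 16 point classes of `S(692, 114240)` and `dim₂ S(692, 114240) = 6` -/

/-- `1 ∈ S(692, 114240)` (the class of `O`). [cite: SilvermanAEC2009, Prop. X.4.9] -/
theorem mem_S_1 : (1 : ℤ) ∈ twoIsogenySelmerGroup 692 114240 := one_mem_twoIsogenySelmerGroup 692 (by norm_num)

/-- `5 ∈ S(692, 114240)`: the class of the rational point `(320, 11840)` of `X'`, i.e. the integral point
`(8, 1, 296)` of `w² = 5u⁴ + 692u²z² + (22848)z⁴`. [cite: SilvermanAEC2009, Prop. X.4.9] -/
theorem mem_S_5 : (5 : ℤ) ∈ twoIsogenySelmerGroup 692 114240 :=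
  (mem_twoIsogenySelmerGroup_iff (by norm_num)).mpr
    ⟨squarefree_int_of_natAbs (n := 5) rfl (by norm_num) (by simp), by norm_num, by
      rw [show (114240 : ℤ) / 5 = 22848 by norm_num]
      exact ⟨isSoluble_of_int_point (u := 8) (z := 1) (w := 296) (Or.inl (by norm_num)) (by norm_num),
        fun p _ => isSoluble_of_int_point (u := 8) (z := 1) (w := 296) (Or.inl (by norm_num)) (by norm_num)⟩⟩

/-- `6 ∈ S(692, 114240)`: the class of the rational point `(24, 1776)` of `X'`, i.e. the integral point
`(2, 1, 148)` of `w² = 6u⁴ + 692u²z² + (19040)z⁴`. [cite: SilvermanAEC2009, Prop. X.4.9] -/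
theorem mem_S_6 : (6 : ℤ) ∈ twoIsogenySelmerGroup 692 114240 :=
  (mem_twoIsogenySelmerGroup_iff (by norm_num)).mpr
    ⟨squarefree_int_of_natAbs (n := 6) rfl (by norm_num) (by simp), by norm_num, by
      rw [show (114240 : ℤ) / 6 = 19040 by norm_num]
      exact ⟨isSoluble_of_int_point (u := 2) (z := 1) (w := 148) (Or.inl (by norm_num)) (by norm_num),
        fun p _ => isSoluble_of_int_point (u := 2) (z := 1) (w := 148) (Or.inl (by norm_num)) (by norm_num)⟩⟩

/-- `-14 ∈ S(692, 114240)`: the class of the rational point `((-2744 / 9), (-29008 / 27))` of `X'`, i.e. the integral point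
`(14, 3, 148)` of `w² = -14u⁴ + 692u²z² + (-8160)z⁴`. [cite: SilvermanAEC2009, Prop. X.4.9] -/
theorem mem_S_m14 : (-14 : ℤ) ∈ twoIsogenySelmerGroup 692 114240 :=
  (mem_twoIsogenySelmerGroup_iff (by norm_num)).mpr
    ⟨squarefree_int_of_natAbs (n := 14) rfl (by norm_num) (by simp), by norm_num, by
      rw [show (114240 : ℤ) / -14 = -8160 by norm_num]
      exact ⟨isSoluble_of_int_point (u := 14) (z := 3) (w := 148) (Or.inl (by norm_num)) (by norm_num),
        fun p _ => isSoluble_of_int_point (u := 14) (z := 3) (w := 148) (Or.inl (by norm_num)) (by norm_num)⟩⟩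

/-- `-17 ∈ S(692, 114240)`: the class of the rational point `((-272), 0)` of `X'`, i.e. the integral point
`(4, 1, 0)` of `w² = -17u⁴ + 692u²z² + (-6720)z⁴`. [cite: SilvermanAEC2009, Prop. X.4.9] -/
theorem mem_S_m17 : (-17 : ℤ) ∈ twoIsogenySelmerGroup 692 114240 :=
  (mem_twoIsogenySelmerGroup_iff (by norm_num)).mpr
    ⟨squarefree_int_of_natAbs (n := 17) rfl (by norm_num) (by simp), by norm_num, by
      rw [show (114240 : ℤ) / -17 = -6720 by norm_num]
      exact ⟨isSoluble_of_int_point (u := 4) (z := 1) (w := 0) (Or.inl (by norm_num)) (by norm_num),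
        fun p _ => isSoluble_of_int_point (u := 4) (z := 1) (w := 0) (Or.inl (by norm_num)) (by norm_num)⟩⟩

/-- `-21 ∈ S(692, 114240)`: the class of the rational point `((-336), 1344)` of `X'`, i.e. the integral point
`(4, 1, 16)` of `w² = -21u⁴ + 692u²z² + (-5440)z⁴`. [cite: SilvermanAEC2009, Prop. X.4.9] -/
theorem mem_S_m21 : (-21 : ℤ) ∈ twoIsogenySelmerGroup 692 114240 :=
  (mem_twoIsogenySelmerGroup_iff (by norm_num)).mpr
    ⟨squarefree_int_of_natAbs (n := 21) rfl (by norm_num) (by simp), by norm_num, by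
      rw [show (114240 : ℤ) / -21 = -5440 by norm_num]
      exact ⟨isSoluble_of_int_point (u := 4) (z := 1) (w := 16) (Or.inl (by norm_num)) (by norm_num),
        fun p _ => isSoluble_of_int_point (u := 4) (z := 1) (w := 16) (Or.inl (by norm_num)) (by norm_num)⟩⟩

/-- `30 ∈ S(692, 114240)`: the class of the rational point `(120, (-5040))` of `X'`, i.e. the integral point
`(2, 1, 84)` of `w² = 30u⁴ + 692u²z² + (3808)z⁴`. [cite: SilvermanAEC2009, Prop. X.4.9] -/
theorem mem_S_30 : (30 : ℤ) ∈ twoIsogenySelmerGroup 692 114240 :=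
  (mem_twoIsogenySelmerGroup_iff (by norm_num)).mpr
    ⟨squarefree_int_of_natAbs (n := 30) rfl (by norm_num) (by simp), by norm_num, by
      rw [show (114240 : ℤ) / 30 = 3808 by norm_num]
      exact ⟨isSoluble_of_int_point (u := 2) (z := 1) (w := 84) (Or.inl (by norm_num)) (by norm_num),
        fun p _ => isSoluble_of_int_point (u := 2) (z := 1) (w := 84) (Or.inl (by norm_num)) (by norm_num)⟩⟩

/-- `-70 ∈ S(692, 114240)`: the class of the rational point `((-280), 560)` of `X'`, i.e. the integral point
`(2, 1, 4)` of `w² = -70u⁴ + 692u²z² + (-1632)z⁴`. [cite: SilvermanAEC2009, Prop. X.4.9] -/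
theorem mem_S_m70 : (-70 : ℤ) ∈ twoIsogenySelmerGroup 692 114240 :=
  (mem_twoIsogenySelmerGroup_iff (by norm_num)).mpr
    ⟨squarefree_int_of_natAbs (n := 70) rfl (by norm_num) (by simp), by norm_num, by
      rw [show (114240 : ℤ) / -70 = -1632 by norm_num]
      exact ⟨isSoluble_of_int_point (u := 2) (z := 1) (w := 4) (Or.inl (by norm_num)) (by norm_num),
        fun p _ => isSoluble_of_int_point (u := 2) (z := 1) (w := 4) (Or.inl (by norm_num)) (by norm_num)⟩⟩

/-- `-85 ∈ S(692, 114240)`: the class of the rational point `((-340), (-1360))` of `X'`, i.e. the integral point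
`(2, 1, 8)` of `w² = -85u⁴ + 692u²z² + (-1344)z⁴`. [cite: SilvermanAEC2009, Prop. X.4.9] -/
theorem mem_S_m85 : (-85 : ℤ) ∈ twoIsogenySelmerGroup 692 114240 :=
  (mem_twoIsogenySelmerGroup_iff (by norm_num)).mpr
    ⟨squarefree_int_of_natAbs (n := 85) rfl (by norm_num) (by simp), by norm_num, by
      rw [show (114240 : ℤ) / -85 = -1344 by norm_num]
      exact ⟨isSoluble_of_int_point (u := 2) (z := 1) (w := 8) (Or.inl (by norm_num)) (by norm_num),
        fun p _ => isSoluble_of_int_point (u := 2) (z := 1) (w := 8) (Or.inl (by norm_num)) (by norm_num)⟩⟩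

/-- `-102 ∈ S(692, 114240)`: the class of the rational point `((-408), (-816))` of `X'`, i.e. the integral point
`(2, 1, 4)` of `w² = -102u⁴ + 692u²z² + (-1120)z⁴`. [cite: SilvermanAEC2009, Prop. X.4.9] -/
theorem mem_S_m102 : (-102 : ℤ) ∈ twoIsogenySelmerGroup 692 114240 :=
  (mem_twoIsogenySelmerGroup_iff (by norm_num)).mpr
    ⟨squarefree_int_of_natAbs (n := 102) rfl (by norm_num) (by simp), by norm_num, by
      rw [show (114240 : ℤ) / -102 = -1120 by norm_num]
      exact ⟨isSoluble_of_int_point (u := 2) (z := 1) (w := 4) (Or.inl (by norm_num)) (by norm_num),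
        fun p _ => isSoluble_of_int_point (u := 2) (z := 1) (w := 4) (Or.inl (by norm_num)) (by norm_num)⟩⟩

/-- `-105 ∈ S(692, 114240)`: the class of the rational point `((-420), 0)` of `X'`, i.e. the integral point
`(2, 1, 0)` of `w² = -105u⁴ + 692u²z² + (-1088)z⁴`. [cite: SilvermanAEC2009, Prop. X.4.9] -/
theorem mem_S_m105 : (-105 : ℤ) ∈ twoIsogenySelmerGroup 692 114240 :=
  (mem_twoIsogenySelmerGroup_iff (by norm_num)).mpr
    ⟨squarefree_int_of_natAbs (n := 105) rfl (by norm_num) (by simp), by norm_num, by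
      rw [show (114240 : ℤ) / -105 = -1088 by norm_num]
      exact ⟨isSoluble_of_int_point (u := 2) (z := 1) (w := 0) (Or.inl (by norm_num)) (by norm_num),
        fun p _ => isSoluble_of_int_point (u := 2) (z := 1) (w := 0) (Or.inl (by norm_num)) (by norm_num)⟩⟩

/-- `238 ∈ S(692, 114240)`: the class of the rational point `(952, 39984)` of `X'`, i.e. the integral point
`(2, 1, 84)` of `w² = 238u⁴ + 692u²z² + (480)z⁴`. [cite: SilvermanAEC2009, Prop. X.4.9] -/
theorem mem_S_238 : (238 : ℤ) ∈ twoIsogenySelmerGroup 692 114240 :=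
  (mem_twoIsogenySelmerGroup_iff (by norm_num)).mpr
    ⟨squarefree_int_of_natAbs (n := 238) rfl (by norm_num) (by simp), by norm_num, by
      rw [show (114240 : ℤ) / 238 = 480 by norm_num]
      exact ⟨isSoluble_of_int_point (u := 2) (z := 1) (w := 84) (Or.inl (by norm_num)) (by norm_num),
        fun p _ => isSoluble_of_int_point (u := 2) (z := 1) (w := 84) (Or.inl (by norm_num)) (by norm_num)⟩⟩

/-- `357 ∈ S(692, 114240)`: the class of the rational point `(357, (-13209))` of `X'`, i.e. the integral point
`(1, 1, 37)` of `w² = 357u⁴ + 692u²z² + (320)z⁴`. [cite: SilvermanAEC2009, Prop. X.4.9] -/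
theorem mem_S_357 : (357 : ℤ) ∈ twoIsogenySelmerGroup 692 114240 :=
  (mem_twoIsogenySelmerGroup_iff (by norm_num)).mpr
    ⟨squarefree_int_of_natAbs (n := 357) rfl (by norm_num) (by simp), by norm_num, by
      rw [show (114240 : ℤ) / 357 = 320 by norm_num]
      exact ⟨isSoluble_of_int_point (u := 1) (z := 1) (w := 37) (Or.inl (by norm_num)) (by norm_num),
        fun p _ => isSoluble_of_int_point (u := 1) (z := 1) (w := 37) (Or.inl (by norm_num)) (by norm_num)⟩⟩

/-- `-510 ∈ S(692, 114240)`: the class of the rational point `((-18360 / 49), (452880 / 343))` of `X'`, i.e. the integral point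
`(6, 7, 148)` of `w² = -510u⁴ + 692u²z² + (-224)z⁴`. [cite: SilvermanAEC2009, Prop. X.4.9] -/
theorem mem_S_m510 : (-510 : ℤ) ∈ twoIsogenySelmerGroup 692 114240 :=
  (mem_twoIsogenySelmerGroup_iff (by norm_num)).mpr
    ⟨squarefree_int_of_natAbs (n := 510) rfl (by norm_num) (by simp), by norm_num, by
      rw [show (114240 : ℤ) / -510 = -224 by norm_num]
      exact ⟨isSoluble_of_int_point (u := 6) (z := 7) (w := 148) (Or.inl (by norm_num)) (by norm_num),
        fun p _ => isSoluble_of_int_point (u := 6) (z := 7) (w := 148) (Or.inl (by norm_num)) (by norm_num)⟩⟩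

/-- `1190 ∈ S(692, 114240)`: the class of the rational point `(4760, (-352240))` of `X'`, i.e. the integral point
`(2, 1, 148)` of `w² = 1190u⁴ + 692u²z² + (96)z⁴`. [cite: SilvermanAEC2009, Prop. X.4.9] -/
theorem mem_S_1190 : (1190 : ℤ) ∈ twoIsogenySelmerGroup 692 114240 :=
  (mem_twoIsogenySelmerGroup_iff (by norm_num)).mpr
    ⟨squarefree_int_of_natAbs (n := 1190) rfl (by norm_num) (by simp), by norm_num, by
      rw [show (114240 : ℤ) / 1190 = 96 by norm_num]
      exact ⟨isSoluble_of_int_point (u := 2) (z := 1) (w := 148) (Or.inl (by norm_num)) (by norm_num),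
        fun p _ => isSoluble_of_int_point (u := 2) (z := 1) (w := 148) (Or.inl (by norm_num)) (by norm_num)⟩⟩

/-- `1785 ∈ S(692, 114240)` (the class `[114240] = [1785]` of `T' = (0,0)`). [cite: SilvermanAEC2009, Prop. X.4.9] -/
theorem mem_S_1785 : (1785 : ℤ) ∈ twoIsogenySelmerGroup 692 114240 :=
  mem_twoIsogenySelmerGroup_of_isSquare (by norm_num)
    (squarefree_int_of_natAbs (n := 1785) rfl (by norm_num) (by simp)) (by norm_num) ⟨8, by norm_num⟩

/-- **`#S(692, 114240) ≥ 33`**: the 16 point classes and the 17 certified classes of `Curve346SelmerAllClasses`.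
[cite: SilvermanAEC2009, Prop. X.4.9] -/
theorem card_twoIsogenySelmerGroup_ge : 33 ≤ (twoIsogenySelmerGroup 692 114240).card := by
  calc 33 = ({1, 5, 6, -14, -17, -21, 30, -70, -85, -102, -105, 238, 357, -510, 1190, 1785, -1, 2, -2, 3, -3, -5, -6, 7, -7, 10, -10, 14, 15, -15, 17, 21, -30} : Finset ℤ).card := by decide
    _ ≤ (twoIsogenySelmerGroup 692 114240).card := by
      refine Finset.card_le_card ?_
      intro d hd
      simp only [Finset.mem_insert, Finset.mem_singleton] at hd
      rcases hd with rfl | rfl | rfl | rfl | rfl | rfl | rfl | rfl | rfl | rfl | rfl | rfl | rfl | rfl | rfl | rfl | rfl | rfl | rfl | rfl | rfl | rfl | rfl | rfl | rfl | rfl | rfl | rfl | rfl | rfl | rfl | rfl | rfl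
      · exact mem_S_1
      · exact mem_S_5
      · exact mem_S_6
      · exact mem_S_m14
      · exact mem_S_m17
      · exact mem_S_m21
      · exact mem_S_30
      · exact mem_S_m70
      · exact mem_S_m85
      · exact mem_S_m102
      · exact mem_S_m105
      · exact mem_S_238
      · exact mem_S_357
      · exact mem_S_m510
      · exact mem_S_1190
      · exact mem_S_1785
      · exact mem_S_m1
      · exact mem_S_2
      · exact mem_S_m2
      · exact mem_S_3
      · exact mem_S_m3
      · exact mem_S_m5
      · exact mem_S_m6
      · exact mem_S_7
      · exact mem_S_m7
      · exact mem_S_10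
      · exact mem_S_m10
      · exact mem_S_14
      · exact mem_S_15
      · exact mem_S_m15
      · exact mem_S_17
      · exact mem_S_21
      · exact mem_S_m30

/-- **`dim₂ S(692, 114240) = 6`**: `2^{dim} = #S` lies between `33` and `2^{ω(114240)+1} = 64`: all `64` classes are everywhere
locally soluble. [cite: SilvermanAEC2009, Prop. X.4.9] -/
theorem twoIsogenySelmerRank_X' : twoIsogenySelmerRank 692 114240 = 6 := by
  have hle : twoIsogenySelmerRank 692 114240 ≤ 6 := by
    have h := twoIsogenySelmerRank_le 692 (b := 114240) (by norm_num)
    have h3 : (114240 : ℤ).natAbs.primeFactors.card = 5 := by decide +kernel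
    omega
  have hge : 33 ≤ 2 ^ twoIsogenySelmerRank 692 114240 := by
    rw [two_pow_twoIsogenySelmerRank_eq_card hab']
    exact card_twoIsogenySelmerGroup_ge
  interval_cases (twoIsogenySelmerRank 692 114240) <;> simp_all

/-- `dim₂ S'(-346, 1369) = dim₂ S(692, 114240) = 6`. [cite: SilvermanAEC2009, Prop. X.4.9] -/
theorem twoIsogenySelmerRank'_X : twoIsogenySelmerRank' (-346) 1369 = 6 := by
  rw [twoIsogenySelmerRank', show (-2 * (-346) : ℤ) = 692 by norm_num, show ((-346 : ℤ) ^ 2 - 4 * 1369 : ℤ) = 114240 by norm_num]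
  exact twoIsogenySelmerRank_X'


end Curve346

end Literature.NumberTheory.EllipticCurves

end
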